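import Literature.Geometry.Lorentzian.NearKerrLeaf
import Literature.Geometry.Lorentzian.TameFarFrame
import HarnessLib

/-!
# Located near-Kerr leaves relative to a far frame (summit `FinalStateConjecture`)

The **located-leaf predicate** `HasLocatedLeaf 𝒟 c Rt T₀ U Φ N M₀ a₀ η k ε R' T₁ K` wanted by the
line `far-tail-peeling-one-leaf` of crux `Capture` (item `stmt-FinalStateConjecture-10115`, routes
`BartnikGapSettling` / `QuietWindowCapture`) of the summit `FinalStateConjecture` (work item
`defn-HasLocatedLeaf`). It is the object the line's core-extraction step (`stub_cores`) produces
and its minimal-decay capture engine (`stub_engine`) consumes: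

*relative to a far frame* — `n` centre curves `c : Fin n → ℝ → E3` in the global chart `E4`, a
tube radius `Rt`, an initial frame time `T₀`, and ONE far chart `Φ : U → 𝒟` (the data of a tame
far frame `IsTameFarFrame`, file `TameFarFrame.lean`, of which only the far zone
`farZone c Rt T₀ = {x⁰ > T₀, |x̲ − cⱼ(x⁰)| > Rt ∀ j}` and the centre distance
`centreDist c x = |x̲ − c(x⁰)|` are used here) — the development `𝒟` carries an
`(ε, k)`-near-Kerr leaf `S` with `N` holes (the block of `CauchyDevelopment.IsNearKerrLeaf`,
VERBATIM, with its witnesses `R ρ mo r B U₀ B₀ Ψ Ψ₀ L W L₀ W₀` exposed) such that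

* the labels `(Mᵢ, aᵢ)` are `η`-PINNED to `(M₀ᵢ, a₀ᵢ)`: `|Mᵢ − M₀ᵢ| ≤ η`, `|aᵢ − a₀ᵢ| ≤ η`;
* `S` is disjoint from `J⁻(K)`;
* there is an assignment `σ : Fin N → Fin n` of labels to centres, injective on the THICK labels
  (`Mᵢ < Rᵢ`), and every label `i` is EITHER an unerased PHANTOM — `Rᵢ ≤ Mᵢ` (the truncated disc
  `{t*ᵢ = 0, rᵢ ≤ Rᵢ}` does not reach the star region `{rᵢ > Mᵢ}`) and the sheet's coordinate cap
  `{t₀ = 0, rᵢ ≤ ρᵢ}` lies in the flat domain `U₀`, so nothing hides there — OR THICK AND LOCATED: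
  `R' ≤ Rᵢ` and the hole chart's outer annulus `Ψᵢ({t*ᵢ = 0, R'/2 ≤ rᵢ ≤ R'})` is charted by the
  far frame at frame times `≥ T₁` within coordinate distance `4R'` of the centre `σ i`:
  `⊆ Φ({y ∈ farZone c Rt T₀ | y⁰ ≥ T₁, centreDist (c (σ i)) y ≤ 4R'})`.

## Also here

* `HasLocatedLeaf.exists_isNearKerrLeaf`: the projection onto the block of `IsNearKerrLeaf`
  (a located leaf is in particular a pinned typed leaf beyond `J⁻(K)`, the shape of the landed
  normal form `HasPinnedLeaves` of the crux hypothesis);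
* `LorentzianMetric.causalPast_mono` (`J⁻` is monotone in the set; time dual of
  `LorentzianMetric.causalFuture_mono` of `Causality.lean`, re-proved privately in several
  summit-side files and recorded once here);
* weakening API: `HasLocatedLeaf.weaken` / `.mono` / `.anti` — a located leaf stays located when the
  order `k` is lowered, the tolerance `ε` or the pinning accuracy `η` is enlarged, the lateness
  threshold `T₁` is lowered, or the compact set `K` is shrunk (`supCkENorm_mono_right`,
  `causalPast_mono`), with the same charts, witnesses and assignment `σ`.

## Sources

Like `IsNearKerrLeaf`, the predicate itself has NO printed source: it is posited by the line's
planner (`planner-cruxplan-stmt-FinalStateConjecture-10115-far-tail-peeling-one-0`, 2026-08-16,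
skeleton `Summits/FinalStateConjecture/FinalStateConjecture/Cruxes/Capture/Lines/
far_tail_peeling_one_leaf.lean`, §1) and recorded here VERBATIM so that the `--supports` files of
the line's registered stubs can state `stub_cores` / `stub_engine` without importing the Lines
file; nothing is asserted about it. Vocabulary: charts with small `Cᵏ` deviation in consequence
form — Dafermos–Holzegel–Rodnianski–Taylor arXiv:2104.08222, §1 (as in `KerrConvergence`,
`NearKerrLeaf`); near charts overlapping one far (wave-zone) chart on an annulus, and the far
zone outside tubes around the centres for all late times — the exterior / "last slice" set-up of
Klainerman–Nicolò 2003, Ch. 3, and Christodoulou–Klainerman 1993, Ch. 17.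

## Mathlib

No Lorentzian geometry, Kerr metric or causal structure in Mathlib; used are
`TopologicalSpace.Opens`, `Topology.IsOpenEmbedding`, `ContMDiffOn`, `Set` algebra, `ℝ≥0∞`.

## Not here

`IsTameFarFrame` / `IsTameFarFrameWithTail` and the far-frame geometry (`centreDist`, `farZone`,
shells, `incomingDeriv`) live in `TameFarFrame.lean` (work item `defn-IsTameFarFrame`, landed
p119587). No relation between located leaves and tame far frames is proved (that is the content
of the line's stubs `stub_cores` / `stub_engine`); in particular a located leaf does not require
`(c, Rt, T₀, U, Φ)` to BE a tame far frame.
-/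

noncomputable section

open Set TopologicalSpace Filter Topology
open scoped Manifold ContDiff Topology ENNReal

universe u

namespace Literature.Geometry.Lorentzian

/-! ### `J⁻` is monotone -/

namespace LorentzianMetric

variable {E : Type*} [NormedAddCommGroup E] [NormedSpace ℝ E] {H : Type*} [TopologicalSpace H]
  {I : ModelWithCorners ℝ E H} {m : ℕ∞ω} {M : Type*} [TopologicalSpace M] [ChartedSpace H M]
  [IsManifold I ∞ M] {g : LorentzianMetric I m M} {τ : TimeOrientation g}

/-- `J⁻` is monotone in the set: `S ⊆ T → J⁻(S) ⊆ J⁻(T)` — the causal past is the causal future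
for the reversed time orientation (`causalPast` unfolds to it) and `J⁺` is monotone
(`causalFuture_mono`). O'Neill 1983, Ch. 14, p. 403 (time duality).
[cite: ONeill1983, Ch. 14 p. 403] -/
theorem causalPast_mono {S T : Set M} (h : S ⊆ T) : g.causalPast τ S ⊆ g.causalPast τ T :=
  LorentzianMetric.causalFuture_mono h

end LorentzianMetric

/-! ### Located leaves -/

section LocatedLeaf

variable {X : Type u} [TopologicalSpace X] [ChartedSpace E3 X] [IsManifold (𝓡 3) ∞ X]
  [ConnectedSpace X] {D : InitialDataSet (𝓡 3) X}

/-- **LOCATED LEAF** of the Cauchy development `𝒟` relative to the far frame `(c, Rt, T₀, U, Φ)`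
(route-posited notion of the line `far-tail-peeling-one-leaf` of crux `Capture` of the final-state
summit — a hypothesis shape, not an assertion; verbatim §1 of the line's skeleton, see the module
docstring): there are labels
`(M, a) : Fin N → ℝ` that are `η`-pinned to `(M₀, a₀)` (`|Mᵢ − M₀ᵢ| ≤ η ∧ |aᵢ − a₀ᵢ| ≤ η`) and a
hypersurface `S ⊆ 𝒟` disjoint from `J⁻(K)`, together with the witnesses
`R ρ mo r B U₀ B₀ Ψ Ψ₀ L W L₀ W₀` of the block of `CauchyDevelopment.IsNearKerrLeaf 𝒟 k ε N M a S`
— its twenty clauses VERBATIM (truncation / overlap radii, motions, boosted Kerr–Schild radii,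
star backgrounds, flat hyperboloidal background, hole charts and flat chart smooth open
embeddings of their layers into `J⁺(ι X)`, `Cᵏ` deviations `≤ ε`, disjoint near zones, mutually
charted overlap annuli, `S = Ψ₀({t₀ = 0}) ∪ ⋃ᵢ Ψᵢ({t*ᵢ = 0, rᵢ ≤ Rᵢ})`, upper layers in
`I⁺(S)`, barrier clause) — plus an assignment `σ : Fin N → Fin n` of labels to centres such that
thick labels (`Mᵢ < Rᵢ`) sit at distinct centres and every label `i` is EITHER an unerased
phantom, `Rᵢ ≤ Mᵢ` with the sheet's coordinate cap `{x⁰ − √(1+|x̲|²) = 0, rᵢ ≤ ρᵢ} ⊆ U₀`, OR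
thick and located, `R' ≤ Rᵢ` with the outer annulus `Ψᵢ({t*ᵢ = 0, R'/2 ≤ rᵢ ≤ R'})` contained in
`Φ({y | y ∈ farZone c Rt T₀, T₁ ≤ y⁰, centreDist (c (σ i)) y ≤ 4R'})` (charted by the far frame,
in its far zone, at frame times `≥ T₁` within `4R'` of centre `σ i`). For an MGHD
`𝒟 : VacuumCauchyDevelopment D` write `HasLocatedLeaf 𝒟.toCauchyDevelopment c Rt T₀ U Φ …`.
Chart / deviation vocabulary in consequence form: DHRT arXiv:2104.08222, §1; near charts glued
to one far wave-zone chart outside tubes for all late times: Klainerman–Nicolò 2003, Ch. 3.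
[cite: DafermosHolzegelRodnianskiTaylor2021, §1] -/
def HasLocatedLeaf (𝒟 : CauchyDevelopment D) {n : ℕ} (c : Fin n → ℝ → E3) (Rt T₀ : ℝ)
    (U : Opens E4) (Φ : U → 𝒟.carrier) (N : ℕ) (M₀ a₀ : Fin N → ℝ) (η : ℝ) (k : ℕ) (ε : ℝ≥0∞)
    (R' T₁ : ℝ) (K : Set 𝒟.carrier) : Prop :=
  ∃ (M a : Fin N → ℝ) (S : Set 𝒟.carrier),
    (∀ i, |M i - M₀ i| ≤ η ∧ |a i - a₀ i| ≤ η) ∧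
    Disjoint S (𝒟.metric.causalPast 𝒟.timeOrientation K) ∧
    ∃ (R ρ : Fin N → ℝ) (mo : Fin N → lorentzGroup × E4) (r : Fin N → E4 → ℝ)
      (B : Fin N → ModelBackground) (U₀ : Opens E4) (B₀ : ModelBackground)
      (Ψ : ∀ i, (B i).domain → 𝒟.carrier) (Ψ₀ : B₀.domain → 𝒟.carrier)
      (L W : ∀ i, Set (B i).domain) (L₀ W₀ : Set B₀.domain),
      (∀ i, r i = fun x => Kerr.radius (a i) (poincareInv (mo i).1 (mo i).2 x)) ∧
      (∀ i, B i = starBackground (mo i).1 (mo i).2 (M i) (a i) (r i)) ∧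
      B₀ = hypBackground U₀ ∧
      (∀ i, L i = {x | -1 < (B i).time x.1 ∧ (B i).time x.1 < 1 ∧ (B i).radius x.1 < R i + 1} ∧
        W i = {x | 0 < (B i).time x.1 ∧ (B i).time x.1 < 1 ∧ (B i).radius x.1 ≤ R i}) ∧
      L₀ = {x | -1 < B₀.time x.1 ∧ B₀.time x.1 < 1} ∧
      W₀ = {x | 0 < B₀.time x.1 ∧ B₀.time x.1 < 1} ∧
      (∀ i, 0 < M i ∧ |a i| ≤ M i ∧ 0 < ρ i ∧ ρ i < R i) ∧
      {x : E4 | -1 < x 0 - Real.sqrt (1 + E4.spatialNorm x ^ 2) ∧ ∀ i, ρ i < r i x} ⊆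
        (U₀ : Set E4) ∧
      (∀ i, ContMDiffOn 𝓘(ℝ, E4) (𝓡 4) ∞ (Ψ i) (L i) ∧ IsOpenEmbedding ((L i).restrict (Ψ i)) ∧
        Ψ i '' L i ⊆ 𝒟.metric.causalFuture 𝒟.timeOrientation (range 𝒟.embed)) ∧
      ContMDiffOn 𝓘(ℝ, E4) (𝓡 4) ∞ Ψ₀ L₀ ∧ IsOpenEmbedding (L₀.restrict Ψ₀) ∧
      Ψ₀ '' L₀ ⊆ 𝒟.metric.causalFuture 𝒟.timeOrientation (range 𝒟.embed) ∧
      (∀ i, 𝒟.toSpacetime.truncDeviationCk (B i) (Ψ i) k (R i) 0 ≤ ε) ∧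
      𝒟.toSpacetime.deviationCk B₀ Ψ₀ k 0 ≤ ε ∧
      Pairwise (Function.onFun Disjoint fun i => Ψ i '' {x | x ∈ L i ∧ (B i).radius x.1 ≤ R i}) ∧
      (∀ i, Ψ i '' {x | (B i).time x.1 = 0 ∧ ρ i < (B i).radius x.1 ∧ (B i).radius x.1 ≤ R i} ⊆
        Ψ₀ '' L₀) ∧
      (∀ i, Ψ₀ '' {x | B₀.time x.1 = 0 ∧ ρ i < r i x.1 ∧ r i x.1 < R i} ⊆ Ψ i '' L i) ∧
      S = Ψ₀ '' B₀.timeSlab 0 ∪ ⋃ i, Ψ i '' (B i).truncTimeSlab (R i) 0 ∧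
      Ψ₀ '' W₀ ∪ ⋃ i, Ψ i '' W i ⊆ 𝒟.metric.chronologicalFuture 𝒟.timeOrientation S ∧
      𝒟.exteriorOf (Ψ₀ '' W₀ ∪ ⋃ i, Ψ i '' W i) \ (Ψ₀ '' W₀ ∪ ⋃ i, Ψ i '' W i) ⊆
        𝒟.metric.causalPast 𝒟.timeOrientation S ∧
      ∃ σ : Fin N → Fin n,
        (∀ i i', M i < R i → M i' < R i' → σ i = σ i' → i = i') ∧
        ∀ i, (R i ≤ M i ∧
            {x : E4 | x 0 - Real.sqrt (1 + E4.spatialNorm x ^ 2) = 0 ∧ r i x ≤ ρ i} ⊆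
              (U₀ : Set E4)) ∨
          (R' ≤ R i ∧
            Ψ i '' {x | (B i).time x.1 = 0 ∧ R' / 2 ≤ (B i).radius x.1 ∧ (B i).radius x.1 ≤ R'} ⊆
              Φ '' {y | y.1 ∈ farZone c Rt T₀ ∧ T₁ ≤ y.1 0 ∧ centreDist (c (σ i)) y.1 ≤ 4 * R'})

namespace HasLocatedLeaf

variable {𝒟 : CauchyDevelopment D} {n : ℕ} {c : Fin n → ℝ → E3} {Rt T₀ : ℝ} {U : Opens E4}
  {Φ : U → 𝒟.carrier} {N : ℕ} {M₀ a₀ : Fin N → ℝ} {η η' : ℝ} {k k' : ℕ} {ε ε' : ℝ≥0∞}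
  {R' T₁ T₁' : ℝ} {K K' : Set 𝒟.carrier}

/-- A located leaf is in particular a pinned typed leaf beyond `J⁻(K)`: projection onto the block
of `CauchyDevelopment.IsNearKerrLeaf` (forget the assignment `σ` and the phantom / located
alternative; the remaining twenty clauses ARE the body of `IsNearKerrLeaf`, so the witnesses are
passed through unchanged). DHRT arXiv:2104.08222, §1 (vocabulary).
[cite: DafermosHolzegelRodnianskiTaylor2021, §1] -/
theorem exists_isNearKerrLeaf (h : HasLocatedLeaf 𝒟 c Rt T₀ U Φ N M₀ a₀ η k ε R' T₁ K) :
    ∃ (M a : Fin N → ℝ) (S : Set 𝒟.carrier), (∀ i, |M i - M₀ i| ≤ η ∧ |a i - a₀ i| ≤ η) ∧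
      Disjoint S (𝒟.metric.causalPast 𝒟.timeOrientation K) ∧ 𝒟.IsNearKerrLeaf k ε N M a S := by
  obtain ⟨M, a, S, hpin, hK, R, ρ, mo, r, B, U₀, B₀, Ψ, Ψ₀, L, W, L₀, W₀, h1, h2, h3, h4, h5, h6,
    h7, h8, h9, h10, h11, h12, h13, h14, h15, h16, h17, h18, h19, h20, -⟩ := h
  exact ⟨M, a, S, hpin, hK, R, ρ, mo, r, B, U₀, B₀, Ψ, Ψ₀, L, W, L₀, W₀, h1, h2, h3, h4, h5, h6,
    h7, h8, h9, h10, h11, h12, h13, h14, h15, h16, h17, h18, h19, h20⟩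

/-- In particular the leaf of a located leaf lies to the causal future of the data hypersurface
and is disjoint from `J⁻(K)` (`IsNearKerrLeaf.subset_causalFuture`). DHRT arXiv:2104.08222, §1
(vocabulary). [cite: DafermosHolzegelRodnianskiTaylor2021, §1] -/
theorem exists_subset_causalFuture (h : HasLocatedLeaf 𝒟 c Rt T₀ U Φ N M₀ a₀ η k ε R' T₁ K) :
    ∃ S : Set 𝒟.carrier, Disjoint S (𝒟.metric.causalPast 𝒟.timeOrientation K) ∧
      S ⊆ 𝒟.metric.causalFuture 𝒟.timeOrientation (range 𝒟.embed) ∧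
      ∃ M a : Fin N → ℝ, 𝒟.IsNearKerrLeaf k ε N M a S := by
  obtain ⟨M, a, S, -, hK, hS⟩ := h.exists_isNearKerrLeaf
  exact ⟨S, hK, hS.subset_causalFuture, M, a, hS⟩

/-- **Weakening.** A located leaf of order `k'`, tolerance `ε`, pinning accuracy `η`, lateness
`T₁`, beyond `J⁻(K)` is a located leaf of order `k ≤ k'`, tolerance `ε' ≥ ε`, accuracy `η' ≥ η`,
lateness `T₁' ≤ T₁`, beyond `J⁻(K')` for `K' ⊆ K` — with the same labels, leaf, charts,
witnesses and assignment: the `Cᵏ` sup norms are monotone in `k` (`supCkENorm_mono_right`),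
`J⁻` is monotone (`causalPast_mono`), and the far-frame target set only grows when `T₁` is
lowered. DHRT arXiv:2104.08222, §1 (closeness with loss of derivatives).
[cite: DafermosHolzegelRodnianskiTaylor2021, §1] -/
theorem weaken (h : HasLocatedLeaf 𝒟 c Rt T₀ U Φ N M₀ a₀ η k' ε R' T₁ K) (hk : k ≤ k')
    (hε : ε ≤ ε') (hη : η ≤ η') (hT : T₁' ≤ T₁) (hK : K' ⊆ K) :
    HasLocatedLeaf 𝒟 c Rt T₀ U Φ N M₀ a₀ η' k ε' R' T₁' K' := by
  obtain ⟨M, a, S, hpin, hSK, R, ρ, mo, r, B, U₀, B₀, Ψ, Ψ₀, L, W, L₀, W₀, h1, h2, h3, h4, h5, h6,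
    h7, h8, h9, h10, h11, h12, h13, h14, h15, h16, h17, h18, h19, h20, σ, hσ, hloc⟩ := h
  refine ⟨M, a, S, fun i ↦ ⟨(hpin i).1.trans hη, (hpin i).2.trans hη⟩,
    hSK.mono_right (LorentzianMetric.causalPast_mono hK), R, ρ, mo, r, B, U₀, B₀, Ψ, Ψ₀, L, W, L₀,
    W₀, h1, h2, h3, h4, h5, h6, h7, h8, h9, h10, h11, h12,
    fun i ↦ ((supCkENorm_mono_right _ hk _).trans (h13 i)).trans hε,
    ((supCkENorm_mono_right _ hk _).trans h14).trans hε, h15, h16, h17, h18, h19, h20, σ, hσ,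
    fun i ↦ (hloc i).imp id fun hi ↦ ⟨hi.1, hi.2.trans (image_mono fun y hy ↦ ?_)⟩⟩
  exact ⟨hy.1, hT.trans hy.2.1, hy.2.2⟩

/-- **Monotonicity in `(k, ε)`** (same shape as `IsNearKerrLeaf.mono`): a located leaf of order
`k'` and tolerance `ε` is one of order `k ≤ k'` and tolerance `ε' ≥ ε`.
DHRT arXiv:2104.08222, §1. [cite: DafermosHolzegelRodnianskiTaylor2021, §1] -/
theorem mono (h : HasLocatedLeaf 𝒟 c Rt T₀ U Φ N M₀ a₀ η k' ε R' T₁ K) (hk : k ≤ k')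
    (hε : ε ≤ ε') : HasLocatedLeaf 𝒟 c Rt T₀ U Φ N M₀ a₀ η k ε' R' T₁ K :=
  h.weaken hk hε le_rfl le_rfl Subset.rfl

/-- **Antitonicity in `K`**: a leaf located beyond `J⁻(K)` is located beyond `J⁻(K')` for every
`K' ⊆ K` (`J⁻` is monotone; O'Neill 1983, Ch. 14, p. 403). [cite: ONeill1983, Ch. 14 p. 403] -/
theorem anti (h : HasLocatedLeaf 𝒟 c Rt T₀ U Φ N M₀ a₀ η k ε R' T₁ K) (hK : K' ⊆ K) :
    HasLocatedLeaf 𝒟 c Rt T₀ U Φ N M₀ a₀ η k ε R' T₁ K' :=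
  h.weaken le_rfl le_rfl le_rfl le_rfl hK

/-- **No holes.** With `N = 0` every `(ε, k)`-near-Kerr leaf disjoint from `J⁻(K)` is a located
leaf relative to ANY far frame `(c, Rt, T₀, U, Φ)` and any `(M₀, a₀, η, R', T₁)`: the pinning,
injectivity and phantom / located clauses are indexed by `Fin 0`, and `σ = Fin.elim0` (partial
converse of `exists_isNearKerrLeaf`; with `NearKerrLeafMinkowski.exists_isNearKerrLeaf` it shows
the predicate is inhabited). DHRT arXiv:2104.08222, §1 (vocabulary).
[cite: DafermosHolzegelRodnianskiTaylor2021, §1] -/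
theorem of_isNearKerrLeaf_zero {P₀ s₀ P s : Fin 0 → ℝ} {S : Set 𝒟.carrier}
    (hS : 𝒟.IsNearKerrLeaf k ε 0 P s S)
    (hK : Disjoint S (𝒟.metric.causalPast 𝒟.timeOrientation K)) :
    HasLocatedLeaf 𝒟 c Rt T₀ U Φ 0 P₀ s₀ η k ε R' T₁ K := by
  obtain ⟨R, ρ, mo, r, B, U₀, B₀, Ψ, Ψ₀, L, W, L₀, W₀, h1, h2, h3, h4, h5, h6, h7, h8, h9, h10, h11,
    h12, h13, h14, h15, h16, h17, h18, h19, h20⟩ := hS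
  exact ⟨P, s, S, fun i ↦ i.elim0, hK, R, ρ, mo, r, B, U₀, B₀, Ψ, Ψ₀, L, W, L₀, W₀, h1, h2, h3, h4,
    h5, h6, h7, h8, h9, h10, h11, h12, h13, h14, h15, h16, h17, h18, h19, h20, Fin.elim0,
    fun i ↦ i.elim0, fun i ↦ i.elim0⟩

/-- The pinning accuracy of a located leaf with at least one hole is nonnegative
(`0 ≤ |M₀ − M₀| ≤ η`). [folklore] -/
theorem pin_nonneg (h : HasLocatedLeaf 𝒟 c Rt T₀ U Φ N M₀ a₀ η k ε R' T₁ K) (i : Fin N) :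
    0 ≤ η := by
  obtain ⟨M, _, _, hpin, -⟩ := h
  exact (abs_nonneg _).trans (hpin i).1

/-- The labels of a located leaf are positive masses `η`-close to the pinned ones, so the pinned
masses exceed `−η`: `−η < M₀ᵢ` (from `0 < Mᵢ` and `|Mᵢ − M₀ᵢ| ≤ η`). [folklore] -/
theorem neg_pin_lt_mass (h : HasLocatedLeaf 𝒟 c Rt T₀ U Φ N M₀ a₀ η k ε R' T₁ K) (i : Fin N) :
    -η < M₀ i := by
  obtain ⟨M, a, S, hpin, -, hleaf⟩ := h.exists_isNearKerrLeaf
  have hM := (hleaf.mass_pos_and_abs_spin_le i).1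
  have h₁ := (abs_le.mp (hpin i).1).2
  linarith

end HasLocatedLeaf

end LocatedLeaf

end Literature.Geometry.Lorentzian

end
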